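import Summits.ResolutionOfSingularities.ResolutionOfSingularities.Theorems.FrobeniusClosingPatchingRelPerfectConeDepthLinePrime
import HarnessLib

/-!
# Crux `PatchingRelPerfect` (stmt-ResolutionOfSingularities-16161), chain W5.2 — rung «r-binary-disc-ℓ»: THE LINE FIBRE THEOREM —
# blowing up the bad line of the binary form `c₁² + b c₁c₂ + a c₂²` (`b² − 4a` a unit): over each point of the line exactly one bad point

[OURS · L1 W5.2 · rung tool] Replaces the role of NO printed item; NOT a statement of the manuscript under review; fact-free,
any characteristic, any residue field.  AI-written (AI review is weaker than expert review).

`σ : X' → X` a blowing up along `J`; at a point `z` with `J_z = (c₀, c₁, c₂)`, `(c; w)` a regular system of parameters of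
`𝒪_{X,z}` (`w` of any length), host `𝓗_z = (c₁² + b c₁c₂ + a c₂²)` with `b² − 4a` a unit, carrier `G_z = (c₀)`, plane sheaves
`P₁_z = (c₁)`, `P₂_z = (c₂)`.  THEN (`line_fibre`): there is a point `z'` over `z` where, in a regular system of parameters
`(c'; w')` of `𝒪_{X',z'}`, the exceptional divisor reads `(c'₀)`, the weight-one transforms of `P₁, P₂` read `(c'₁), (c'₂)`, the
weight-two transform of `𝓗` reads `(c'₁² + b' c'₁c'₂ + a' c'₂²)` with `b'² − 4a'` a unit, and the transform of `G` is `⊤`; at every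
OTHER point over `z` the transforms of `𝓗`, the exceptional divisor and the transform of `G` have simple normal crossings, and one of
the transforms of `P₁, P₂` is the unit ideal there (the new bad line meets the fibre only at `z'`).

## References
* J. Kollár, *Lectures on Resolution of Singularities* (2007), Def. 3.24, 3.61. [Kollar2007]
* The Stacks Project, Tags 0804, 0BIQ. [StacksProject]
* H. Matsumura, *Commutative Ring Theory*, CUP 1986, Thm. 14.2, Thm. 30.3. [Matsumura1987]
-/

set_option linter.dupNamespace false

noncomputable section

open CategoryTheory CategoryTheory.Limits AlgebraicGeometry TopologicalSpace IsLocalRing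
open Literature.AlgebraicGeometry.Resolution
open Scheme.IdealSheafData
open scoped Pointwise

namespace Summit.ResolutionOfSingularities.ResolutionOfSingularities.Theorems

universe u

namespace ConeDepth

section LineFibre

variable {X' X : Scheme.{u}} {σ : X' ⟶ X} {J : X.IdealSheafData}
  (hσ : IsBlowup σ J) (z : X) (c : Fin 3 → X.presheaf.stalk z) {l : ℕ} (w : Fin l → X.presheaf.stalk z)
  [IsRegularLocalRing (X.presheaf.stalk z)]
  (hz𝔪 : Ideal.span (Set.range (Fin.append c w)) = maximalIdeal (X.presheaf.stalk z))
  (hd : (maximalIdeal (X.presheaf.stalk z)).spanFinrank = 3 + l)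
  (hJ : stalkIdeal J z = Ideal.span (Set.range c))
  (a b : X.presheaf.stalk z) (hD : IsUnit (b ^ 2 - 4 * a))
  (𝓗 G P₁ P₂ : X.IdealSheafData)
  (h𝓗 : stalkIdeal 𝓗 z = Ideal.span {c 1 * c 1 + b * (c 1 * c 2) + a * (c 2 * c 2)})
  (hG : stalkIdeal G z = Ideal.span {c 0}) (hP₁ : stalkIdeal P₁ z = Ideal.span {c 1}) (hP₂ : stalkIdeal P₂ z = Ideal.span {c 2})
  (q : (j : Fin 3) → (Spec (.of (chartRing c j)) ⟶ X'))
  (hqσ : ∀ j, q j ≫ σ = Spec.map (CommRingCat.ofHom (chartBase c j)) ≫ X.fromSpecStalk z)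
  (hqiso : ∀ j (w' : Spec (.of (chartRing c j))), IsIso ((q j).stalkMap w'))

include hσ hJ h𝓗 hG hP₁ hP₂ hqσ hqiso in
omit [IsRegularLocalRing (X.presheaf.stalk z)] in
/-- **Presentation of a point of the fibre on chart `j`** with the five stalks of interest: exceptional divisor `(φ c_j)`, host
transform `(f_j)`, old carrier `(e₀)`, planes `(e₁)`, `(e₂)`. [cite: StacksProject, Tag 0804] -/
theorem line_presentation (j : Fin 3) (w' : PrimeSpectrum (chartRing c j)) (x' : X') (hx' : q j w' = x') (hz' : σ x' = z) :
    ∃ χ : chartRing c j →+* X'.presheaf.stalk x',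
      @IsLocalization.AtPrime _ _ (X'.presheaf.stalk x') _ χ.toAlgebra w'.asIdeal _ ∧
      w'.asIdeal.comap (chartBase c j) = maximalIdeal (X.presheaf.stalk z) ∧
      stalkIdeal (J.comap σ) x' = Ideal.span {χ (chartBase c j (c j))} ∧
      stalkIdeal (controlledTransform σ J 𝓗 2) x' = Ideal.span {χ (chartGen c j 1 * chartGen c j 1 +
        chartBase c j b * (chartGen c j 1 * chartGen c j 2) + chartBase c j a * (chartGen c j 2 * chartGen c j 2))} ∧
      stalkIdeal (controlledTransform σ J G 1) x' = Ideal.span {χ (chartGen c j 0)} ∧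
      stalkIdeal (controlledTransform σ J P₁ 1) x' = Ideal.span {χ (chartGen c j 1)} ∧
      stalkIdeal (controlledTransform σ J P₂ 1) x' = Ideal.span {χ (chartGen c j 2)} := by
  classical
  have hc : Ideal.span (Set.range c) = stalkIdeal J z := hJ.symm
  haveI := hqiso j w'
  obtain ⟨χ, hχ, hloc, hw𝔪⟩ := exists_stalk_presentation c j (q j) (hqσ j) w' hx' hz'
  letI : Algebra (chartRing c j) (X'.presheaf.stalk x') := χ.toAlgebra
  haveI := hloc
  have hnzd : χ (chartBase c j (c j)) ∈ nonZeroDivisors (X'.presheaf.stalk x') :=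
    algebraMap_centre_mem_nonZeroDivisors c j (X'.presheaf.stalk x') (chartBase c j)
      (reesChartBase_mem_nonZeroDivisors (c j) (Ideal.mem_span_range_self (f := c) (x := j))) w'.asIdeal
  refine ⟨χ, hloc, hw𝔪, stalkIdeal_exceptional_of_presentation χ hz' hχ hc, ?_, ?_, ?_, ?_⟩
  · exact stalkIdeal_controlledTransform_of_presentation χ hz' hχ hσ hc hnzd 𝓗 _ h𝓗 2 _
      (by rw [chartBase_binaryForm c a b j, map_mul, map_pow])
  · exact stalkIdeal_controlledTransform_of_presentation χ hz' hχ hσ hc hnzd G _ hG 1 (chartGen c j 0)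
      (by rw [reesChartBase_apply_eq_mul_chartGen c j 0, map_mul, pow_one])
  · exact stalkIdeal_controlledTransform_of_presentation χ hz' hχ hσ hc hnzd P₁ _ hP₁ 1 (chartGen c j 1)
      (by rw [reesChartBase_apply_eq_mul_chartGen c j 1, map_mul, pow_one])
  · exact stalkIdeal_controlledTransform_of_presentation χ hz' hχ hσ hc hnzd P₂ _ hP₂ 1 (chartGen c j 2)
      (by rw [reesChartBase_apply_eq_mul_chartGen c j 2, map_mul, pow_one])

include hqσ hz𝔪 hd hJ hD h𝓗 hG hP₁ hP₂ hσ hqiso in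
/-- **The fibre over the line point: the NEW LINE POINT.**  At `z' = q₀(line prime)`: a regular system of parameters `(c'; w')`
with `E' = (c'₀)`, `P₁' = (c'₁)`, `P₂' = (c'₂)`, `𝓗' = (c'₁² + b' c'₁c'₂ + a' c'₂²)` (`b'² − 4a'` a unit), `G' = ⊤`.
[cite: StacksProject, Tag 0804] -/
theorem lineFibre_line (x₀ : X') (hx₀ : q 0 (linePoint c w hz𝔪 hd) = x₀) :
    ∃ (c' : Fin 3 → X'.presheaf.stalk x₀) (w' : Fin l → X'.presheaf.stalk x₀),
      IsRegularLocalRing (X'.presheaf.stalk x₀) ∧ Ideal.span (Set.range (Fin.append c' w')) = maximalIdeal _ ∧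
      (maximalIdeal (X'.presheaf.stalk x₀)).spanFinrank = 3 + l ∧
      stalkIdeal (J.comap σ) x₀ = Ideal.span {c' 0} ∧
      stalkIdeal (controlledTransform σ J P₁ 1) x₀ = Ideal.span {c' 1} ∧
      stalkIdeal (controlledTransform σ J P₂ 1) x₀ = Ideal.span {c' 2} ∧
      (∃ a' b' : X'.presheaf.stalk x₀, IsUnit (b' ^ 2 - 4 * a') ∧
        stalkIdeal (controlledTransform σ J 𝓗 2) x₀ = Ideal.span {c' 1 * c' 1 + b' * (c' 1 * c' 2) + a' * (c' 2 * c' 2)}) ∧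
      stalkIdeal (controlledTransform σ J G 1) x₀ = ⊤ := by
  classical
  have hwv : (linePoint c w hz𝔪 hd).asIdeal.comap (chartBase c 0) = maximalIdeal _ := comap_lineIdeal c w hz𝔪 hd
  have hz₀ : σ x₀ = z := by rw [← hx₀]; exact apply_chart_eq_of_comap (hqσ 0) _ hwv
  obtain ⟨χ, hloc, -, hE, hH, hGs, hP1, hP2⟩ :=
    line_presentation hσ z c hJ a b 𝓗 G P₁ P₂ h𝓗 hG hP₁ hP₂ q hqσ hqiso 0 (linePoint c w hz𝔪 hd) x₀ hx₀ hz₀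
  letI : Algebra (chartRing c 0) (X'.presheaf.stalk x₀) := χ.toAlgebra
  haveI := hloc
  haveI : (linePoint c w hz𝔪 hd).asIdeal.IsPrime := (linePoint c w hz𝔪 hd).isPrime
  obtain ⟨hv, hv0, hv1, hv2⟩ := lineVertex c w hz𝔪 hd (linePoint c w hz𝔪 hd).asIdeal hwv (X'.presheaf.stalk x₀)
    (chartGen_mem_chartStageIdeal c 0 _ (by simp)) (chartGen_mem_chartStageIdeal c 0 _ (by simp))
  set v := chartFamily c 0 w (X'.presheaf.stalk x₀) (chartBase c 0) (chartGen c 0)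
    (fun k : Fin 2 => (⟨k.succ, Fin.succ_ne_zero k⟩ : {j : Fin 3 // j ≠ (0 : Fin 3)})) with hvdef
  -- the new regular system `(c'; w')`
  obtain ⟨c', hc'0, hc'1, hc'2⟩ : ∃ c' : Fin 3 → X'.presheaf.stalk x₀,
      c' 0 = χ (chartBase c 0 (c 0)) ∧ c' 1 = χ (chartGen c 0 1) ∧ c' 2 = χ (chartGen c 0 2) :=
    ⟨Fin.cons (χ (chartBase c 0 (c 0))) (Fin.cons (χ (chartGen c 0 1)) (Fin.cons (χ (chartGen c 0 2)) Fin.elim0)),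
      rfl, rfl, rfl⟩
  obtain ⟨w', hw'⟩ : ∃ w' : Fin l → X'.presheaf.stalk x₀, ∀ k, w' k = χ (chartBase c 0 (w k)) := ⟨_, fun k => rfl⟩
  -- the members of `v` one by one
  have hvw : ∀ k : Fin l, v (Fin.succ (Fin.natAdd 2 k)) = χ (chartBase c 0 (w k)) := by
    intro k
    rw [hvdef, chartFamily, Fin.cons_succ, Fin.append_right]
    rfl
  -- `range (c'; w') = range v`
  have hrange : Set.range (Fin.append c' w') = Set.range v := by
    apply Set.Subset.antisymm
    · rintro _ ⟨i, rfl⟩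
      refine Fin.addCases (fun j => ?_) (fun k => ?_) i
      · rw [Fin.append_left]
        revert j
        intro j
        match j with
        | 0 => exact ⟨0, hv0.trans hc'0.symm⟩
        | 1 => exact ⟨Fin.succ (Fin.castAdd l 0), hv1.trans hc'1.symm⟩
        | 2 => exact ⟨Fin.succ (Fin.castAdd l 1), hv2.trans hc'2.symm⟩
      · rw [Fin.append_right]
        exact ⟨Fin.succ (Fin.natAdd 2 k), (hvw k).trans (hw' k).symm⟩
    · rintro _ ⟨i, rfl⟩
      refine Fin.cases ?_ (fun i => ?_) i
      · exact ⟨Fin.castAdd l 0, by rw [Fin.append_left, hc'0]; exact hv0.symm⟩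
      · refine Fin.addCases (fun k => ?_) (fun k => ?_) i
        · match k with
          | 0 => exact ⟨Fin.castAdd l 1, by rw [Fin.append_left, hc'1]; exact hv1.symm⟩
          | 1 => exact ⟨Fin.castAdd l 2, by rw [Fin.append_left, hc'2]; exact hv2.symm⟩
        · exact ⟨Fin.natAdd 3 k, by rw [Fin.append_right, hw']; exact (hvw k).symm⟩
  -- `(v) = 𝔪`
  have hspan : Ideal.span (Set.range v) = maximalIdeal (X'.presheaf.stalk x₀) := by
    rw [← IsLocalization.AtPrime.map_eq_maximalIdeal (linePoint c w hz𝔪 hd).asIdeal (X'.presheaf.stalk x₀)]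
    apply le_antisymm
    · rw [Ideal.span_le]
      rintro _ ⟨k, rfl⟩
      have := hv.mem_maximalIdeal k
      rwa [← IsLocalization.AtPrime.map_eq_maximalIdeal (linePoint c w hz𝔪 hd).asIdeal (X'.presheaf.stalk x₀)] at this
    · have hlp : (linePoint c w hz𝔪 hd).asIdeal = chartStageIdeal c 0 (Ideal.span (Set.range w)) ({1, 2} : Set (Fin 3)) := rfl
      rw [hlp, Ideal.map_le_iff_le_comap, chartStageIdeal]
      refine sup_le (sup_le ?_ ?_) ?_
      · rw [Ideal.span_singleton_le_iff_mem, Ideal.mem_comap]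
        exact Ideal.subset_span ⟨0, hv0⟩
      · rw [Ideal.map_le_iff_le_comap, Ideal.span_le]
        rintro _ ⟨k, rfl⟩
        rw [SetLike.mem_coe, Ideal.mem_comap, Ideal.mem_comap]
        exact Ideal.subset_span ⟨Fin.succ (Fin.natAdd 2 k), hvw k⟩
      · rw [Ideal.span_le]
        rintro _ ⟨j, hj, rfl⟩
        simp only [Set.mem_insert_iff, Set.mem_singleton_iff] at hj
        rw [SetLike.mem_coe, Ideal.mem_comap]
        rcases hj with rfl | rfl
        · exact Ideal.subset_span ⟨_, hv1⟩
        · exact Ideal.subset_span ⟨_, hv2⟩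
  have hspan' : Ideal.span (Set.range (Fin.append c' w')) = maximalIdeal (X'.presheaf.stalk x₀) := by rw [hrange, hspan]
  haveI hreg' : IsRegularLocalRing (X'.presheaf.stalk x₀) := hv.isRegularLocalRing
  refine ⟨c', w', hreg', hspan', ?_, by rw [hE, hc'0], by rw [hP1, hc'1], by rw [hP2, hc'2],
    ⟨χ (chartBase c 0 a), χ (chartBase c 0 b), ?_, ?_⟩, ?_⟩
  · -- `μ(𝔪) = 3 + l`
    obtain ⟨e, -, hde, -, -⟩ := hv.exists_rsop
    have hle : (maximalIdeal (X'.presheaf.stalk x₀)).spanFinrank ≤ 3 + l := by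
      rw [← hspan', ← Set.image_univ]
      refine (Submodule.spanFinrank_span_le_ncard_of_finite (Set.toFinite _)).trans ?_
      refine (Set.ncard_image_le (Set.toFinite _)).trans ?_
      rw [Set.ncard_univ, Nat.card_eq_fintype_card, Fintype.card_fin]
    omega
  · have h := hD.map ((χ).comp (chartBase c 0))
    rwa [map_sub, map_pow, map_mul, map_ofNat] at h
  · refine hH.trans ?_
    simp only [map_add, map_mul, hc'1, hc'2]
  · have h1 : chartGen c 0 0 = 1 := chartGen_self c 0
    rw [hGs, h1, map_one, Ideal.span_singleton_one]

include hσ hz𝔪 hd hJ hD h𝓗 hG hP₁ hP₂ hqσ hqiso in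
/-- **The fibre of the line point, chart `0`, off the new line point**: simple normal crossings of `[𝓗', E', G']`, and one of the
plane transforms is the unit ideal. [cite: Kollar2007, Def. 3.24] -/
theorem line_sncWithAt_chart_zero (w' : PrimeSpectrum (chartRing c 0)) (x' : X') (hx' : q 0 w' = x') (hz' : σ x' = z)
    (hne : x' ≠ q 0 (linePoint c w hz𝔪 hd)) :
    DepthSNC.SNCWithAt [controlledTransform σ J 𝓗 2, J.comap σ, controlledTransform σ J G 1] ⊤ x' ∧
      (x' ∉ (controlledTransform σ J P₁ 1).support ∨ x' ∉ (controlledTransform σ J P₂ 1).support) := by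
  classical
  obtain ⟨χ, hloc, hw𝔪, hE, hH, hGs, hP1, hP2⟩ :=
    line_presentation hσ z c hJ a b 𝓗 G P₁ P₂ h𝓗 hG hP₁ hP₂ q hqσ hqiso 0 w' x' hx' hz'
  letI : Algebra (chartRing c 0) (X'.presheaf.stalk x') := χ.toAlgebra
  haveI := hloc
  have hnl : ¬ (chartGen c 0 1 ∈ w'.asIdeal ∧ chartGen c 0 2 ∈ w'.asIdeal) := by
    rintro ⟨h1, h2⟩
    have hw : w'.asIdeal = (linePoint c w hz𝔪 hd).asIdeal := eq_lineIdeal c w hz𝔪 hd w'.asIdeal hw𝔪 h1 h2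
    exact hne (by rw [← hx', PrimeSpectrum.ext hw])
  have hG' : x' ∉ (controlledTransform σ J G 1).support := by
    intro hx
    have h1 : chartGen c 0 0 = 1 := chartGen_self c 0
    have hmem := mem_of_mem_support χ w'.asIdeal hloc hGs hx
    rw [h1] at hmem
    exact w'.isPrime.ne_top ((Ideal.eq_top_iff_one _).mpr hmem)
  have hne' := (binaryHost_ne c w hz𝔪 hd a b 0).1
  refine ⟨?_, ?_⟩
  · have key : DepthSNC.SNCWithAt ([(J.comap σ, chartBase c 0 (c 0)),
        (controlledTransform σ J 𝓗 2, chartGen c 0 1 * chartGen c 0 1 + chartBase c 0 b * (chartGen c 0 1 * chartGen c 0 2) +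
          chartBase c 0 a * (chartGen c 0 2 * chartGen c 0 2))].map Prod.fst) ⊤ x' := by
      refine sncWithAt_of_adapted χ w'.asIdeal hloc _ ?_ ?_ ?_
      · intro p hp
        simp only [List.mem_cons, List.not_mem_nil, or_false] at hp
        rcases hp with rfl | rfl
        · exact hE
        · exact hH
      · intro p hp p' hp' h
        simp only [List.mem_cons, List.not_mem_nil, or_false] at hp hp'
        rcases hp with rfl | rfl <;> rcases hp' with rfl | rfl
        · rfl
        · exact absurd h.symm hne'
        · exact absurd h hne'
        · rfl
      · exact lineChart_zero c w hz𝔪 hd a b hD w'.asIdeal hw𝔪 (X'.presheaf.stalk x') hnl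
    refine key.anti fun D hD' hxD => ?_
    simp only [List.mem_cons, List.not_mem_nil, or_false] at hD'
    simp only [List.map_cons, List.map_nil, List.mem_cons, List.not_mem_nil, or_false]
    rcases hD' with rfl | rfl | rfl
    · exact Or.inr rfl
    · exact Or.inl rfl
    · exact absurd hxD hG'
  · by_cases h1 : chartGen c 0 1 ∈ w'.asIdeal
    · right
      intro hx
      exact hnl ⟨h1, mem_of_mem_support χ w'.asIdeal hloc hP2 hx⟩
    · left
      intro hx
      exact h1 (mem_of_mem_support χ w'.asIdeal hloc hP1 hx)

include hσ hz𝔪 hd hJ hD h𝓗 hG hP₁ hP₂ hqσ hqiso in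
/-- **The fibre of the line point, charts `i ≠ 0`**: simple normal crossings of `[𝓗', E', G']` (`lineChart_one` / `lineChart_two`),
and the `i`-th plane transform is the unit ideal. [cite: Kollar2007, Def. 3.24] -/
theorem line_sncWithAt_chart_ne_zero (i : Fin 3) (hi0 : i ≠ 0) (w' : PrimeSpectrum (chartRing c i)) (x' : X')
    (hx' : q i w' = x') (hz' : σ x' = z) :
    DepthSNC.SNCWithAt [controlledTransform σ J 𝓗 2, J.comap σ, controlledTransform σ J G 1] ⊤ x' ∧
      (x' ∉ (controlledTransform σ J P₁ 1).support ∨ x' ∉ (controlledTransform σ J P₂ 1).support) := by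
  classical
  obtain ⟨χ, hloc, hw𝔪, hE, hH, hGs, hP1, hP2⟩ :=
    line_presentation hσ z c hJ a b 𝓗 G P₁ P₂ h𝓗 hG hP₁ hP₂ q hqσ hqiso i w' x' hx' hz'
  letI : Algebra (chartRing c i) (X'.presheaf.stalk x') := χ.toAlgebra
  haveI := hloc
  obtain ⟨hn1, hn2⟩ := binaryHost_ne c w hz𝔪 hd a b i
  have hn2 := hn2 (Ne.symm hi0)
  have hn3 := chartGen_zero_ne_chartBase₃ c w hz𝔪 hd i (Ne.symm hi0)
  have hi12 : i = 1 ∨ i = 2 := by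
    fin_cases i
    · exact absurd rfl hi0
    · exact Or.inl rfl
    · exact Or.inr rfl
  have had : ∃ (m : ℕ) (v : Fin m → X'.presheaf.stalk x')
      (ι : {g : chartRing c i // g ∈ [chartBase c i (c i), chartGen c i 0,
        chartGen c i 1 * chartGen c i 1 + chartBase c i b * (chartGen c i 1 * chartGen c i 2) +
          chartBase c i a * (chartGen c i 2 * chartGen c i 2)] ∧ g ∈ w'.asIdeal} → Fin m),
      IsRsopPart v ∧ Function.Injective ι ∧
        ∀ g, v (ι g) = (algebraMap (chartRing c i) (X'.presheaf.stalk x') : chartRing c i →+* X'.presheaf.stalk x') g.1 := by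
    rcases hi12 with rfl | rfl
    · exact lineChart_one c w hz𝔪 hd a b hD w'.asIdeal hw𝔪 (X'.presheaf.stalk x')
    · exact lineChart_two c w hz𝔪 hd a b hD w'.asIdeal hw𝔪 (X'.presheaf.stalk x')
  refine ⟨?_, ?_⟩
  · have key : DepthSNC.SNCWithAt ([(J.comap σ, chartBase c i (c i)), (controlledTransform σ J G 1, chartGen c i 0),
        (controlledTransform σ J 𝓗 2, chartGen c i 1 * chartGen c i 1 + chartBase c i b * (chartGen c i 1 * chartGen c i 2) +
          chartBase c i a * (chartGen c i 2 * chartGen c i 2))].map Prod.fst) ⊤ x' := by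
      refine sncWithAt_of_adapted χ w'.asIdeal hloc _ ?_ ?_ had
      · intro p hp
        simp only [List.mem_cons, List.not_mem_nil, or_false] at hp
        rcases hp with rfl | rfl | rfl
        · exact hE
        · exact hGs
        · exact hH
      · intro p hp p' hp' h
        simp only [List.mem_cons, List.not_mem_nil, or_false] at hp hp'
        rcases hp with rfl | rfl | rfl <;> rcases hp' with rfl | rfl | rfl
        · rfl
        · exact absurd h.symm hn3
        · exact absurd h.symm hn1
        · exact absurd h hn3
        · rfl
        · exact absurd h.symm hn2
        · exact absurd h hn1
        · exact absurd h hn2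
        · rfl
    refine key.anti fun D hD' _ => ?_
    simp only [List.mem_cons, List.not_mem_nil, or_false] at hD'
    simp only [List.map_cons, List.map_nil, List.mem_cons, List.not_mem_nil, or_false]
    rcases hD' with rfl | rfl | rfl
    · exact Or.inr (Or.inr rfl)
    · exact Or.inl rfl
    · exact Or.inr (Or.inl rfl)
  · -- the `i`-th plane transform is the unit ideal at `x'` (`e_i = 1`)
    have h1 : chartGen c i i = 1 := chartGen_self c i
    rcases hi12 with rfl | rfl
    · left
      intro hx
      have hmem := mem_of_mem_support χ w'.asIdeal hloc hP1 hx
      rw [h1] at hmem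
      exact w'.isPrime.ne_top ((Ideal.eq_top_iff_one _).mpr hmem)
    · right
      intro hx
      have hmem := mem_of_mem_support χ w'.asIdeal hloc hP2 hx
      rw [h1] at hmem
      exact w'.isPrime.ne_top ((Ideal.eq_top_iff_one _).mpr hmem)

end LineFibre

/-- **THE LINE FIBRE THEOREM.**  Blow up `X` along `J` with `J_z = (c₀, c₁, c₂)` for a regular system of parameters `(c; w)` of
`𝒪_{X,z}`; follow the binary-form host `𝓗_z = (c₁² + b c₁c₂ + a c₂²)` (`b² − 4a` a unit), the carrier `G_z = (c₀)` and the planes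
`P₁_z = (c₁)`, `P₂_z = (c₂)`.  Over `z` there is exactly one bad point `z'`: there the configuration reproduces itself one level
up (`E' = (c'₀)`, `P_k' = (c'_k)`, `𝓗' = (N'(c'₁, c'₂))`, `G' = ⊤` in a regular system `(c'; w')`); at every other point over `z`
the three sheaves `𝓗', E', G'` have simple normal crossings and one plane transform is trivial. [cite: Kollar2007, 3.61]
[cite: StacksProject, Tag 0804] -/
theorem line_fibre {X' X : Scheme.{u}} {σ : X' ⟶ X} {J : X.IdealSheafData} (hσ : IsBlowup σ J) (z : X)
    (c : Fin 3 → X.presheaf.stalk z) {l : ℕ} (w : Fin l → X.presheaf.stalk z) [IsRegularLocalRing (X.presheaf.stalk z)]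
    (hz𝔪 : Ideal.span (Set.range (Fin.append c w)) = maximalIdeal (X.presheaf.stalk z))
    (hd : (maximalIdeal (X.presheaf.stalk z)).spanFinrank = 3 + l) (hJ : stalkIdeal J z = Ideal.span (Set.range c))
    (a b : X.presheaf.stalk z) (hD : IsUnit (b ^ 2 - 4 * a)) (𝓗 G P₁ P₂ : X.IdealSheafData)
    (h𝓗 : stalkIdeal 𝓗 z = Ideal.span {c 1 * c 1 + b * (c 1 * c 2) + a * (c 2 * c 2)})
    (hG : stalkIdeal G z = Ideal.span {c 0}) (hP₁ : stalkIdeal P₁ z = Ideal.span {c 1})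
    (hP₂ : stalkIdeal P₂ z = Ideal.span {c 2}) :
    ∃ z' : X', σ z' = z ∧
      (∃ (c' : Fin 3 → X'.presheaf.stalk z') (w' : Fin l → X'.presheaf.stalk z'),
        IsRegularLocalRing (X'.presheaf.stalk z') ∧ Ideal.span (Set.range (Fin.append c' w')) = maximalIdeal _ ∧
        (maximalIdeal (X'.presheaf.stalk z')).spanFinrank = 3 + l ∧
        stalkIdeal (J.comap σ) z' = Ideal.span {c' 0} ∧
        stalkIdeal (controlledTransform σ J P₁ 1) z' = Ideal.span {c' 1} ∧
        stalkIdeal (controlledTransform σ J P₂ 1) z' = Ideal.span {c' 2} ∧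
        (∃ a' b' : X'.presheaf.stalk z', IsUnit (b' ^ 2 - 4 * a') ∧
          stalkIdeal (controlledTransform σ J 𝓗 2) z' = Ideal.span {c' 1 * c' 1 + b' * (c' 1 * c' 2) + a' * (c' 2 * c' 2)}) ∧
        stalkIdeal (controlledTransform σ J G 1) z' = ⊤) ∧
      ∀ x' : X', σ x' = z → x' ≠ z' →
        DepthSNC.SNCWithAt [controlledTransform σ J 𝓗 2, J.comap σ, controlledTransform σ J G 1] ⊤ x' ∧
          (x' ∉ (controlledTransform σ J P₁ 1).support ∨ x' ∉ (controlledTransform σ J P₂ 1).support) := by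
  classical
  obtain ⟨q, hqσ, hqiso, hcov⟩ := exists_charts_over hσ z c hJ.symm
  refine ⟨q 0 (linePoint c w hz𝔪 hd), ?_,
    lineFibre_line hσ z c w hz𝔪 hd hJ a b hD 𝓗 G P₁ P₂ h𝓗 hG hP₁ hP₂ q hqσ hqiso _ rfl, ?_⟩
  · exact apply_chart_eq_of_comap (hqσ 0) _ (comap_lineIdeal c w hz𝔪 hd)
  · intro x' hx' hne
    obtain ⟨j, w', hqw⟩ := hcov x' hx'
    fin_cases j
    · exact line_sncWithAt_chart_zero hσ z c w hz𝔪 hd hJ a b hD 𝓗 G P₁ P₂ h𝓗 hG hP₁ hP₂ q hqσ hqiso w' x' hqw hx' hne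
    · exact line_sncWithAt_chart_ne_zero hσ z c w hz𝔪 hd hJ a b hD 𝓗 G P₁ P₂ h𝓗 hG hP₁ hP₂ q hqσ hqiso 1 (by decide) w' x' hqw hx'
    · exact line_sncWithAt_chart_ne_zero hσ z c w hz𝔪 hd hJ a b hD 𝓗 G P₁ P₂ h𝓗 hG hP₁ hP₂ q hqσ hqiso 2 (by decide) w' x' hqw hx'

end ConeDepth

end Summit.ResolutionOfSingularities.ResolutionOfSingularities.Theorems

end
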